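import Literature.Analysis.FluidPDE.NSLerayHopf
import Literature.Analysis.FluidPDE.NSHopfGalerkinExistence
import Literature.Analysis.FluidPDE.NSHopfGalerkinLimit
import Literature.Analysis.FunctionSpaces.TorusAxisAverage
import HarnessLib

/-!
# Hopf's existence theorem on `𝕋³` in the closed `x₃`-invariant class: the invariant
  Galerkin scheme and its invariant limit (proof of `NS.hopf_existence_torus_invariant`)

Trunk: FluidKinetic. `Literature/Analysis/FluidPDE/NSLerayHopf` records, at the request of route
`AnomalousDissipation/TwoAndHalfD`, the named fact `Literature.Analysis.FluidPDE.hopf_existence_torus_invariant`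
(**ns.S06′**): Hopf's global existence theorem for Leray–Hopf weak solutions on the flat torus
`𝕋³` *within the closed class of fields invariant under all translations along the third
coordinate axis* (`x ↦ x + s e₃`, `s : UnitAddCircle`) — for invariant datum `u₀` and force `f`
there is a global Leray–Hopf weak solution all of whose slices are invariant. No print states
Leray–Hopf existence with the invariance clause; it is the folklore remark that Hopf's
Faedo–Galerkin proof (Hopf 1951, §§2–4; Robinson–Rodrigo–Sadowski 2016, Thm. 4.4;
Constantin–Foias 1988, Ch. 8, Theorem (Leray)) runs verbatim inside the closed subspace of
`x₃`-independent fields — the Fourier modes with `k₃ = 0` — because the Galerkin vector field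
maps that subspace to itself (the "two-and-a-half-dimensional" structure, Majda–Bertozzi 2002,
§2.3.1, Prop. 2.7; Bruè–De Lellis 2023, §3.1).

This file decomposes the fact along the two halves of the printed proof, exactly parallel to the
decomposition of `NS.hopf_existence_torus` in `Literature/Analysis/FluidPDE/NSHopfGalerkin`
(`hopf_galerkin_scheme_exists` / `hopf_galerkin_limit`, interface `NS.IsHopfGalerkinScheme`),
and **proves both halves**, reusing the whole Galerkin programme of `NSHopfGalerkinExistence`,
`NSHopfLimit`, `NSHopfEnergy`, `NSHopfGalerkinLimit` (all of whose limit lemmas are generic in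
the limit field):

* `NS.hopf_galerkin_scheme_exists_invariant` — for invariant data there is a Hopf–Galerkin
  scheme `(N, F, U)` all of whose approximations `U n t` and smoothed forces `F n t` are invariant
  under the axis translations (named fact, **discharged**:
  `NS.hopf_galerkin_scheme_exists_invariant_holds`, from `NS.exists_isHopfGalerkinScheme_invariant`
  in every dimension and for every coordinate axis);
* `NS.hopf_galerkin_limit_invariant` — every Hopf–Galerkin scheme whose approximations are
  invariant (for `t ≥ 0`) has a global Leray–Hopf limit all of whose slices are invariant
  (named fact, **discharged**: `NS.hopf_galerkin_limit_invariant_holds`; Robinson–Rodrigo–Sadowski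
  2016, Thm. 4.4 Steps 3–4, Thm. 4.6, Cor. 4.7, Thm. 4.11, run in the invariant subspace, the
  limit `L²` class being given its everywhere-invariant representative, the axis average
  `Torus.axisAvg` of `Literature/Analysis/FunctionSpaces/TorusAxisAverage`);
* `NS.hopf_existence_torus_invariant_of_galerkin` — the **assembly** (real proof), and
  `NS.hopf_existence_torus_invariant_of_galerkin_limit` — the reduction of **ns.S06′** to the
  named fact `hopf_galerkin_limit_invariant`;
* `NS.IsHopfGalerkinScheme.exists_invariant_limitField` — **the invariant limit field** (real
  proof): for a scheme with invariant approximations, the limit field of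
  `IsHopfGalerkinScheme.exists_limitField` (`NSHopfLimit`) may be taken invariant at every
  point, with the same standing properties (`hum`/`hu`/`hc`) consumed by all the limit lemmas of
  `NSHopfLimit`/`NSHopfEnergy` — the limit coefficients vanish off `k₃ = 0` and the `L²` class is
  represented by its axis average `Torus.axisAvg`;
* `NS.hopf_galerkin_limit_invariant_holds` — **discharge of the second half** from the invariant
  limit field and `IsHopfGalerkinScheme.isLerayHopfOn_limit` of `NSHopfGalerkinLimit` (the
  coefficientwise limit of a scheme is Leray–Hopf on every `[0, T)`);
* `NS.hopf_existence_torus_invariant_holds` — **discharge of ns.S06′**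
  `NS.hopf_existence_torus_invariant`.

## The invariant Galerkin scheme (all proved, every dimension `d`, every axis `i`)

* `NS.axisCoeffSubspace S i` — the coefficient vectors on the frequency set `S` vanishing at all
  frequencies with `kᵢ ≠ 0` (the Fourier coordinates of the `xᵢ`-independent trigonometric
  polynomials), a real subspace; `NS.axisProj i` — the coordinate projection onto it (zeroing the
  modes `kᵢ ≠ 0`), which keeps real (conjugate-symmetric) vectors real and smooth curves smooth.
* `NS.galerkinField_eq_zero_of_apply_ne_zero`, `NS.galerkinRHS_mem_axisCoeffSubspace` — **the
  Galerkin vector field preserves the subspace**: the Stokes term is diagonal in `k`, the Leray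
  symbol acts frequency-wise, the force is projected, and the convection symbol
  `∑_{l+m=k} (2πi c_l·m) c'_m` has no output at `kᵢ ≠ 0` when `c`, `c'` have no modes with
  `lᵢ ≠ 0`, `mᵢ ≠ 0` (since `kᵢ = lᵢ + mᵢ`) — the Fourier form of "(u·∇)v is `x₃`-independent when
  `u`, `v` are" (Majda–Bertozzi 2002, Prop. 2.7).
* `NS.exists_galerkin_solution_of_invariant` — global solutions of the Galerkin ODE inside any
  closed subspace `W` of the Galerkin phase space mapped to itself by the field (the proof of
  `NS.exists_galerkin_solution` of `NSHopfGalerkinExistence`, run in `W`: local Lipschitz bound,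
  energy a priori bound, `ODE.exists_solution_of_apriori_bound`).
* `NS.lintegral_enorm_sq_realTrigPoly_axisProj_sub_le` — projecting the coefficients of an
  approximant onto the modes `kᵢ = 0` does not increase its `L²` distance to a field without
  modes `kᵢ ≠ 0` (slice Parseval), so the smoothed forces of
  `Torus.exists_smooth_realTrigPoly_approx` may be taken invariant.
* `NS.exists_isHopfGalerkinScheme_invariant` — the assembly of the scheme, as in
  `NS.exists_isHopfGalerkinScheme`, with data `(û₀(k))_{|k| ≤ n}` (no modes `kᵢ ≠ 0` by
  `Torus.mFourierCoeff_eq_zero_of_forall_add_single`) and the invariance of `U n t`, `F n t` read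
  off from `Torus.realTrigPoly_add_single`.

## Mathlib search

Mathlib (this pin) has no Navier–Stokes / Galerkin material (searched `Galerkin`, `NavierStokes`:
only `Literature/`); the scheme, the Galerkin field and the ODE theory are those of
`NSHopfGalerkin`, `NSGalerkinFourier`, `NSHopfGalerkinExistence`, `Literature/Analysis/ODE`.

## References

* E. Hopf, *Über die Anfangswertaufgabe für die hydrodynamischen Grundgleichungen*, Math. Nachr.
  4 (1951), 213–231, §§2–4.
* J. C. Robinson, J. L. Rodrigo, W. Sadowski, *The three-dimensional Navier–Stokes equations*
  (CUP 2016), §4.1, Thm. 4.4 (Steps 1–4), Thm. 4.6, Cor. 4.7, Thm. 4.11.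
* P. Constantin, C. Foias, *Navier–Stokes Equations* (Chicago 1988), Ch. 8, (8.3)–(8.17),
  Theorem (Leray), p. 47.
* A. J. Majda, A. L. Bertozzi, *Vorticity and Incompressible Flow* (CUP 2002), §2.3.1, Prop. 2.7
  (two-and-a-half-dimensional flows).
* E. Bruè, C. De Lellis, *Anomalous dissipation for the forced 3D Navier–Stokes equations*,
  Comm. Math. Phys. 400 (2023), §3.1.
-/

open MeasureTheory Set Filter Topology UnitAddTorus Metric Function
open scoped ENNReal NNReal InnerProductSpace

noncomputable section

namespace Literature.Analysis.FluidPDE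

section NS

open FunctionSpaces.Torus Torus

variable {d : Type*} [Fintype d] [DecidableEq d]

/-! ## Coefficient vectors without modes `kᵢ ≠ 0` -/

section AxisCoeff

variable {S : Finset (d → ℤ)}

variable (S) in
/-- **The axis-invariant coefficient vectors** on the finite frequency set `S`: those vanishing
at every frequency `k ∈ S` with `kᵢ ≠ 0` — the Fourier coordinates of the vector trigonometric
polynomials over `S` that do not depend on `xᵢ` (`Torus.realTrigPoly_add_single`,
`Torus.mFourierCoeff_eq_zero_of_forall_add_single`), i.e. of the Galerkin space intersected
with the two-and-a-half-dimensional fields (Majda–Bertozzi 2002, §2.3.1). A real subspace of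
`↥S → ℂ^d`. [folklore] -/
def axisCoeffSubspace (i : d) : Submodule ℝ (↥S → EuclideanSpace ℂ d) where
  carrier := {c | ∀ k : ↥S, (k : d → ℤ) i ≠ 0 → c k = 0}
  zero_mem' := fun _ _ => rfl
  add_mem' := by
    intro c c' hc hc' k hk
    simp only [Pi.add_apply, hc k hk, hc' k hk, add_zero]
  smul_mem' := by
    intro a c hc k hk
    simp only [Pi.smul_apply, hc k hk, smul_zero]

omit [Fintype d] [DecidableEq d] in
/-- Membership in `axisCoeffSubspace`, unfolded. [folklore] -/
theorem mem_axisCoeffSubspace {i : d} {c : ↥S → EuclideanSpace ℂ d} :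
    c ∈ axisCoeffSubspace S i ↔ ∀ k : ↥S, (k : d → ℤ) i ≠ 0 → c k = 0 := Iff.rfl

omit [DecidableEq d] in
/-- The extension by zero of an axis-invariant coefficient vector vanishes at every frequency
with `kᵢ ≠ 0` (on `S` by hypothesis, off `S` by definition). [folklore] -/
theorem coeffExt_eq_zero_of_mem_axisCoeffSubspace {i : d} {c : ↥S → EuclideanSpace ℂ d}
    (hc : c ∈ axisCoeffSubspace S i) {k : d → ℤ} (hk : k i ≠ 0) : coeffExt S c k = 0 := by
  by_cases hkS : k ∈ S
  · rw [coeffExt_of_mem _ hkS]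
    exact hc ⟨k, hkS⟩ hk
  · exact coeffExt_of_not_mem _ hkS

omit [DecidableEq d] in
/-- **The convection symbol has no output at frequencies `kᵢ ≠ 0`** when neither argument has
modes with nonzero `i`-th frequency: every pair `l + m = k` has `lᵢ ≠ 0` or `mᵢ ≠ 0`
(Fourier form of "`(u·∇)v` does not depend on `xᵢ` when `u`, `v` do not";
Majda–Bertozzi 2002, §2.3.1, Prop. 2.7). [folklore] -/
theorem convectionCoeff_eq_zero_of_apply_ne_zero {c c' : (d → ℤ) → EuclideanSpace ℂ d} {i : d}
    (hc : ∀ k, k i ≠ 0 → c k = 0) (hc' : ∀ k, k i ≠ 0 → c' k = 0) {k : d → ℤ} (hk : k i ≠ 0) :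
    convectionCoeff S c c' k = 0 := by
  rw [convectionCoeff_def]
  refine Finset.sum_eq_zero fun l _ => Finset.sum_eq_zero fun m _ => ?_
  split_ifs with hlm
  · by_cases hl : l i = 0
    · have hm : m i ≠ 0 := by
        intro hm
        apply hk
        rw [← hlm, Pi.add_apply, hl, hm, add_zero]
      rw [hc' m hm, smul_zero]
    · rw [hc l hl]
      simp
  · rfl

omit [DecidableEq d] in
/-- **The Galerkin vector field preserves the absence of modes `kᵢ ≠ 0`**: if the force and the
state coefficients vanish at all frequencies with `kᵢ ≠ 0`, so does `galerkinField ν S g c`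
(the Stokes term is diagonal, the Leray symbol acts frequency-wise, and
`convectionCoeff_eq_zero_of_apply_ne_zero`). [folklore] -/
theorem galerkinField_eq_zero_of_apply_ne_zero (ν : ℝ) {g c : (d → ℤ) → EuclideanSpace ℂ d}
    {i : d} (hg : ∀ k, k i ≠ 0 → g k = 0) (hc : ∀ k, k i ≠ 0 → c k = 0) {k : d → ℤ}
    (hk : k i ≠ 0) : galerkinField ν S g c k = 0 := by
  rw [galerkinField_def, hc k hk, smul_zero, neg_zero, zero_add, hg k hk,
    convectionCoeff_eq_zero_of_apply_ne_zero hc hc hk, sub_zero, leraySym_zero]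

omit [DecidableEq d] in
/-- **Invariance of the axis-invariant subspace under the Galerkin field** on coefficient
vectors: for force coefficients in `axisCoeffSubspace S i`, `galerkinRHS S ν g` maps
`axisCoeffSubspace S i` into itself. [folklore] -/
theorem galerkinRHS_mem_axisCoeffSubspace (ν : ℝ) {i : d} {g c : ↥S → EuclideanSpace ℂ d}
    (hg : g ∈ axisCoeffSubspace S i) (hc : c ∈ axisCoeffSubspace S i) :
    galerkinRHS S ν g c ∈ axisCoeffSubspace S i := fun _ hk =>
  galerkinField_eq_zero_of_apply_ne_zero ν (fun _ hl => coeffExt_eq_zero_of_mem_axisCoeffSubspace hg hl)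
    (fun _ hl => coeffExt_eq_zero_of_mem_axisCoeffSubspace hc hl) hk

/-- **The projection onto the axis-invariant coefficient vectors**: keep the coordinates at
frequencies with `kᵢ = 0`, zero the others (the Fourier coordinates of the axis average
`Torus.axisAvg` of a trigonometric polynomial). [folklore] -/
def axisProj (i : d) (c : ↥S → EuclideanSpace ℂ d) : ↥S → EuclideanSpace ℂ d :=
  fun k => if (k : d → ℤ) i = 0 then c k else 0

omit [Fintype d] [DecidableEq d] in
/-- Unfolding `axisProj`. [folklore] -/
theorem axisProj_apply (i : d) (c : ↥S → EuclideanSpace ℂ d) (k : ↥S) :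
    axisProj i c k = if (k : d → ℤ) i = 0 then c k else 0 := rfl

omit [Fintype d] [DecidableEq d] in
/-- The projection lands in the axis-invariant subspace. [folklore] -/
theorem axisProj_mem (i : d) (c : ↥S → EuclideanSpace ℂ d) : axisProj i c ∈ axisCoeffSubspace S i :=
  fun _ hk => if_neg hk

omit [Fintype d] [DecidableEq d] in
/-- The projection keeps real (conjugate-symmetric) coefficient vectors real: the set of
frequencies with `kᵢ = 0` is symmetric under `k ↦ -k`. [folklore] -/
theorem IsRealCoeff.axisProj {c : ↥S → EuclideanSpace ℂ d} (hc : IsRealCoeff c) (i : d) :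
    IsRealCoeff (axisProj i c) := by
  intro k l hkl
  have hli : (l : d → ℤ) i = -((k : d → ℤ) i) := by rw [hkl, Pi.neg_apply]
  by_cases hki : (k : d → ℤ) i = 0
  · have hli0 : (l : d → ℤ) i = 0 := by rw [hli, hki, neg_zero]
    rw [axisProj_apply, axisProj_apply, if_pos hli0, if_pos hki, hc k l hkl]
  · have hli0 : (l : d → ℤ) i ≠ 0 := by rwa [hli, neg_ne_zero]
    rw [axisProj_apply, axisProj_apply, if_neg hli0, if_neg hki, FunctionSpaces.EuclideanSpace.conjVec_zero]

omit [DecidableEq d] in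
/-- The projection of a `Cⁿ` coefficient curve is `Cⁿ` (coordinatewise it is either a coordinate
of the curve or zero). [folklore] -/
theorem ContDiff.axisProj {n : WithTop ℕ∞} {g : ℝ → ↥S → EuclideanSpace ℂ d} (hg : ContDiff ℝ n g)
    (i : d) : ContDiff ℝ n fun t => axisProj i (g t) := by
  refine contDiff_pi.2 fun k => ?_
  by_cases hk : (k : d → ℤ) i = 0
  · simp_rw [axisProj_apply, if_pos hk]
    exact contDiff_pi.1 hg k
  · simp_rw [axisProj_apply, if_neg hk]
    exact contDiff_const

omit [DecidableEq d] in
/-- **Projecting onto the modes `kᵢ = 0` does not increase the `L²` distance to a field without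
modes `kᵢ ≠ 0`.** For a real coefficient vector `c` on a symmetric `S` and `u ∈ L²(T^d; ℝ^d)`
with `û(k) = 0` whenever `kᵢ ≠ 0`,
`∫ ‖realTrigPoly S (axisProj i c) - u‖² ≤ ∫ ‖realTrigPoly S c - u‖²`: by the slice Parseval
identity `Torus.lintegral_enorm_sq_realTrigPoly_sub` both sides are `∑_{k∈S} ‖c' k - û k‖²` plus
the same tail, and the terms with `kᵢ ≠ 0` are `0 ≤ ‖c k‖²`. [folklore] -/
theorem lintegral_enorm_sq_realTrigPoly_axisProj_sub_le (hS : ∀ k ∈ S, -k ∈ S) {i : d}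
    {c : ↥S → EuclideanSpace ℂ d} (hc : IsRealCoeff c) {u : UnitAddTorus d → EuclideanSpace ℝ d}
    (hu : MemLp u 2 volume)
    (hu0 : ∀ k : d → ℤ, k i ≠ 0 → mFourierCoeff (FunctionSpaces.EuclideanSpace.complexify ∘ u) k = 0) :
    ∫⁻ x, ‖realTrigPoly S (coeffExt S (axisProj i c)) x - u x‖ₑ ^ 2 ≤
      ∫⁻ x, ‖realTrigPoly S (coeffExt S c) x - u x‖ₑ ^ 2 := by
  rw [lintegral_enorm_sq_realTrigPoly_sub hS (IsRealCoeff.axisProj hc i) hu,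
    lintegral_enorm_sq_realTrigPoly_sub hS hc hu]
  refine add_le_add (Finset.sum_le_sum fun k _ => ?_) le_rfl
  by_cases hk : (k : d → ℤ) i = 0
  · rw [axisProj_apply, if_pos hk]
  · rw [axisProj_apply, if_neg hk, hu0 k hk]
    simp

end AxisCoeff

/-! ## The Galerkin ODE inside an invariant closed subspace -/

section Global

variable {S : Finset (d → ℤ)}

/-- **Global solutions of the Galerkin system inside an invariant subspace**
(Robinson–Rodrigo–Sadowski 2016, Thm. 4.4, Steps 1–2, pp. 74–75; Constantin–Foias 1988, Ch. 8,
(8.5)–(8.9); Hopf 1951, §2 — run in a closed subspace). Let `S` be a finite symmetric frequency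
set, `ν ≥ 0`, `g : ℝ → (S → ℂ^d)` continuous with `g t` real for all `t`, and let `W` be a
subspace of the Galerkin phase space `galerkinSubspace S` (real, divergence-free coefficient
vectors) mapped into itself by the Galerkin field `galerkinRHS S ν (g t)` for every `t`. Then for
every `c₀ ∈ W` the Galerkin ODE `α' = V(g(t), α)` has a solution with `α 0 = c₀` taking values
in `W`, continuous on `[0, ∞)`, solving the equation on every `[0, T]`. Proof: that of
`NS.exists_galerkin_solution` with the phase space `W` — `ODE.exists_solution_of_apriori_bound`
in the complete space `W`, the local Lipschitz bound `norm_galerkinRHS_sub_le` and the a priori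
energy bound `energy_apriori_bound` (which only uses `W ≤ galerkinSubspace S`). The case
`W = galerkinSubspace S` is `NS.exists_galerkin_solution`; the case of interest is the
intersection with `axisCoeffSubspace S i`. [cite: RobinsonRodrigoSadowski2016, Thm. 4.4 Steps 1–2] -/
theorem exists_galerkin_solution_of_invariant (ν : ℝ) (hν : 0 ≤ ν) (hS : ∀ k ∈ S, -k ∈ S)
    {g : ℝ → ↥S → EuclideanSpace ℂ d} (hg : Continuous g) (hgr : ∀ t, IsRealCoeff (g t))
    (W : Submodule ℝ (↥S → EuclideanSpace ℂ d)) (hW : W ≤ galerkinSubspace S)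
    (hWinv : ∀ t, ∀ c ∈ W, galerkinRHS S ν (g t) c ∈ W)
    {c₀ : ↥S → EuclideanSpace ℂ d} (hc₀ : c₀ ∈ W) :
    ∃ α : ℝ → ↥S → EuclideanSpace ℂ d, α 0 = c₀ ∧ (∀ t, α t ∈ W) ∧
      ContinuousOn α (Ici 0) ∧
      ∀ T, ∀ t ∈ Icc 0 T, HasDerivWithinAt α (galerkinRHS S ν (g t) (α t)) (Icc 0 T) t := by
  set Y := W with hY
  -- the vector field on the phase space
  set V : ℝ → Y → Y := fun t c => ⟨galerkinRHS S ν (g t) c, hWinv t c c.2⟩ with hV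
  have hVcoe : ∀ t (c : Y), ((V t c : Y) : ↥S → EuclideanSpace ℂ d) = galerkinRHS S ν (g t) c :=
    fun t c => rfl
  -- Lipschitz on balls, uniformly in time
  have hlip : ∀ T ρ : ℝ, ∃ K : ℝ≥0, ∀ t ∈ Icc 0 T, LipschitzOnWith K (V t) (closedBall 0 ρ) := by
    intro T ρ
    refine ⟨Real.toNNReal (‖ν‖ * (4 * Real.pi ^ 2 * ∑ k ∈ S, freqNormSq k) +
        2 * (2 * Real.pi * (S.card * ∑ m ∈ S, ∑ j, |(m j : ℝ)|) * ρ)), fun t _ => ?_⟩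
    refine LipschitzOnWith.of_dist_le_mul fun c hc c' hc' => ?_
    rw [mem_closedBall, dist_zero_right] at hc hc'
    rw [Subtype.dist_eq, dist_eq_norm, dist_eq_norm, hVcoe, hVcoe]
    have h := norm_galerkinRHS_sub_le ν (g t) (ρ := ρ) (c := (c : ↥S → EuclideanSpace ℂ d))
      (c' := (c' : ↥S → EuclideanSpace ℂ d)) (by simpa using hc) (by simpa using hc')
    refine h.trans (mul_le_mul_of_nonneg_right (Real.le_coe_toNNReal _) (norm_nonneg _))
  -- continuity in time
  have hcont : ∀ c : Y, ContinuousOn (V · c) (Ici 0) := by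
    intro c
    refine Continuous.continuousOn ?_
    exact (continuous_galerkinRHS_left ν hg (c : ↥S → EuclideanSpace ℂ d)).subtype_mk _
  -- a priori bound
  have hapriori : ∀ T : ℝ, 0 ≤ T → ∃ R : ℝ, ‖(⟨c₀, hc₀⟩ : Y)‖ ≤ R ∧
      ∀ s ∈ Icc 0 T, ∀ α : ℝ → Y, α 0 = ⟨c₀, hc₀⟩ →
        (∀ t ∈ Icc 0 s, HasDerivWithinAt α (V t (α t)) (Icc 0 s) t) →
        ∀ t ∈ Icc 0 s, ‖α t‖ ≤ R := by
    intro T hT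
    obtain ⟨Cg, hCg⟩ := isCompact_Icc.exists_bound_of_continuousOn (hg.continuousOn (s := Icc 0 T))
    set R : ℝ := Real.sqrt ((∑ k, ‖c₀ k‖ ^ 2 + S.card * Cg ^ 2) * Real.exp T) with hR
    have hE0 : ∑ k, ‖c₀ k‖ ^ 2 ≤ (∑ k, ‖c₀ k‖ ^ 2 + S.card * Cg ^ 2) * Real.exp T := by
      have h1 : 1 ≤ Real.exp T := Real.one_le_exp hT
      have hε : 0 ≤ (S.card : ℝ) * Cg ^ 2 := by positivity
      have hψ0 : 0 ≤ ∑ k, ‖c₀ k‖ ^ 2 := Finset.sum_nonneg fun k _ => sq_nonneg _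
      nlinarith
    refine ⟨R, ?_, ?_⟩
    · change ‖c₀‖ ≤ R
      exact (norm_le_sqrt_sum_norm_sq c₀).trans (Real.sqrt_le_sqrt hE0)
    · intro s hs α hα0 hα t ht
      -- transport to `S → ℂ^d`
      set β : ℝ → ↥S → EuclideanSpace ℂ d := fun τ => (α τ : ↥S → EuclideanSpace ℂ d) with hβ
      have hβ' : ∀ τ ∈ Icc 0 s, HasDerivWithinAt β (galerkinRHS S ν (g τ) (β τ)) (Icc 0 s) τ := by
        intro τ hτ
        exact Y.subtypeL.hasFDerivAt.comp_hasDerivWithinAt τ (hα τ hτ)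
      have hmem : ∀ τ ∈ Icc 0 s, β τ ∈ galerkinSubspace S := fun τ _ => hW (α τ).2
      have hb := energy_apriori_bound ν hν hS hgr hCg hs.2 hβ' hmem t ht
      have hβ0 : β 0 = c₀ := by simp [hβ, hα0]
      rw [hβ0] at hb
      change ‖β t‖ ≤ R
      exact (norm_le_sqrt_sum_norm_sq (β t)).trans (Real.sqrt_le_sqrt hb)
  obtain ⟨α, hα0, hα⟩ := ODE.exists_solution_of_apriori_bound hlip hcont hapriori
  refine ⟨fun t => (α t : ↥S → EuclideanSpace ℂ d), by simp [hα0], fun t => (α t).2, ?_, ?_⟩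
  · intro t ht
    have hc := IsIntegralCurveOn.continuousOn (hα (t + 1)) t ⟨ht, by linarith⟩
    have hmem : Icc 0 (t + 1) ∈ 𝓝[Ici 0] t :=
      Filter.mem_of_superset (inter_mem_nhdsWithin (Ici (0 : ℝ)) (Iio_mem_nhds (by linarith)))
        fun s hs => ⟨hs.1, hs.2.le⟩
    exact (continuous_subtype_val.continuousAt.comp_continuousWithinAt hc).mono_of_mem_nhdsWithin
      hmem
  · intro T t ht
    exact Y.subtypeL.hasFDerivAt.comp_hasDerivWithinAt t (hα T t ht)

end Global

/-! ## The invariant Hopf–Galerkin scheme in every dimension -/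

section Scheme

/-- **Existence of an invariant Hopf–Galerkin scheme** (Robinson–Rodrigo–Sadowski 2016,
Thm. 4.4, Steps 1–2; Constantin–Foias 1988, Ch. 8, (8.3)–(8.9); Hopf 1951, §§2–3 — run in the
closed subspace of fields invariant under the translations along the `i`-th axis). Let `ν > 0`,
`u₀ ∈ L²(T^d; ℝ^d)` weakly divergence free, `f` space–time measurable with `∫₀ᵀ ∫ ‖f‖² < ∞` for
every `T > 0` (hypotheses of `NS.exists_isHopfGalerkinScheme`), and assume that `u₀` and every
slice `f t` are invariant under all translations `x ↦ x + s eᵢ`, `s : UnitAddCircle`. Then there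
is a Hopf–Galerkin scheme `(N, F, U)` for `(ν, f, u₀)` (`NS.IsHopfGalerkinScheme`) all of whose
approximations `U n t` and smoothed forces `F n t` (all `n`, all `t`) are invariant under the
same translations. Construction: `N = id`; the smoothed force coefficients of
`Torus.exists_smooth_realTrigPoly_approx` projected by `axisProj i` (still smooth, real, and
converging to `f` in `L²ₜL²ₓ` by `lintegral_enorm_sq_realTrigPoly_axisProj_sub_le`, as `f t` has
no modes `kᵢ ≠ 0`); `U n` the global solution of the `n`-th Galerkin ODE in
`galerkinSubspace ⊓ axisCoeffSubspace` (`exists_galerkin_solution_of_invariant`,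
`galerkinRHS_mem_axisCoeffSubspace`) from the datum `(û₀(k))_{|k| ≤ n}`, which has no modes
`kᵢ ≠ 0` (`Torus.mFourierCoeff_eq_zero_of_forall_add_single`); the clauses of the scheme exactly
as in `NS.exists_isHopfGalerkinScheme`, and the invariance by `Torus.realTrigPoly_add_single`. [cite: RobinsonRodrigoSadowski2016, Thm. 4.4 Steps 1–2] -/
theorem exists_isHopfGalerkinScheme_invariant (ν : ℝ) (hν : 0 < ν)
    (u₀ : UnitAddTorus d → EuclideanSpace ℝ d) (hu₀ : MemLp u₀ 2 volume)
    (hdiv : FunctionSpaces.Torus.IsWeaklyDivFree u₀) (f : ℝ → UnitAddTorus d → EuclideanSpace ℝ d)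
    (hf : AEStronglyMeasurable (stLift f) (volume.restrict (Ioi 0 ×ˢ univ)))
    (hf₂ : ∀ T, 0 < T → ∫⁻ t in Ioo 0 T, ∫⁻ x, ‖f t x‖ₑ ^ 2 < ⊤) (i : d)
    (hu₀inv : ∀ (s : UnitAddCircle) (x : UnitAddTorus d), u₀ (x + Pi.single i s) = u₀ x)
    (hfinv : ∀ (t : ℝ) (s : UnitAddCircle) (x : UnitAddTorus d), f t (x + Pi.single i s) = f t x) :
    ∃ (N : ℕ → ℕ) (F U : ℕ → ℝ → UnitAddTorus d → EuclideanSpace ℝ d),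
      IsHopfGalerkinScheme ν f u₀ N F U ∧
      (∀ n (t : ℝ) (s : UnitAddCircle) (x : UnitAddTorus d), U n t (x + Pi.single i s) = U n t x) ∧
      (∀ n (t : ℝ) (s : UnitAddCircle) (x : UnitAddTorus d), F n t (x + Pi.single i s) = F n t x) := by
  -- Fourier coefficients of the invariant data vanish off the hyperplane `k i = 0`
  have hu₀c : ∀ k : d → ℤ, k i ≠ 0 → mFourierCoeff (FunctionSpaces.EuclideanSpace.complexify ∘ u₀) k = 0 :=
    fun k hk => mFourierCoeff_eq_zero_of_forall_add_single (f := FunctionSpaces.EuclideanSpace.complexify ∘ u₀)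
      (fun s x => by simp only [comp_apply, hu₀inv s x]) hk
  have hfc : ∀ t (k : d → ℤ), k i ≠ 0 → mFourierCoeff (FunctionSpaces.EuclideanSpace.complexify ∘ f t) k = 0 :=
    fun t k hk => mFourierCoeff_eq_zero_of_forall_add_single (f := FunctionSpaces.EuclideanSpace.complexify ∘ f t)
      (fun s x => by simp only [comp_apply, hfinv t s x]) hk
  -- the smoothed forces, projected onto the modes `k i = 0`
  obtain ⟨g, hg_smooth, hg_real, hg_tend⟩ := exists_smooth_realTrigPoly_approx hf hf₂
  set g' : (n : ℕ) → ℝ → (↥(freqBall (d := d) n) → EuclideanSpace ℂ d) :=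
    fun n t => axisProj i (g n t) with hg'_def
  have hg'_smooth : ∀ n, ContDiff ℝ ((⊤ : ℕ∞) : WithTop ℕ∞) (g' n) := fun n =>
    ContDiff.axisProj (hg_smooth n) i
  have hg'_real : ∀ n t, IsRealCoeff (g' n t) := fun n t => IsRealCoeff.axisProj (hg_real n t) i
  have hg'_mem : ∀ n t, g' n t ∈ axisCoeffSubspace (freqBall n) i := fun n t => axisProj_mem i _
  have hg'_cont : ∀ n, Continuous (g' n) := fun n => (hg'_smooth n).continuous
  have hS : ∀ n : ℕ, ∀ k ∈ freqBall (d := d) n, -k ∈ freqBall n := fun n =>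
    neg_mem_freqBall_of_mem
  have hg'_tend : ∀ T, 0 < T → Tendsto (fun n => ∫⁻ t in Ioo 0 T,
      ∫⁻ x, ‖realTrigPoly (freqBall n) (coeffExt (freqBall n) (g' n t)) x - f t x‖ₑ ^ 2)
      atTop (𝓝 0) := by
    intro T hT
    refine tendsto_of_tendsto_of_tendsto_of_le_of_le tendsto_const_nhds (hg_tend T hT)
      (fun n => zero_le) fun n => ?_
    refine lintegral_mono_ae ?_
    filter_upwards [ae_memLp_slice hf (hf₂ T hT)] with t ht
    exact lintegral_enorm_sq_realTrigPoly_axisProj_sub_le (hS n) (hg_real n t) ht (hfc t)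
  -- the data of the Galerkin systems: `(û₀(k))_{|k| ≤ n}`, inside the invariant subspaces
  set W : (n : ℕ) → Submodule ℝ (↥(freqBall (d := d) n) → EuclideanSpace ℂ d) :=
    fun n => galerkinSubspace (freqBall n) ⊓ axisCoeffSubspace (freqBall n) i with hW_def
  set c₀ : (n : ℕ) → ↥(freqBall (d := d) n) → EuclideanSpace ℂ d :=
    fun n k => mFourierCoeff (FunctionSpaces.EuclideanSpace.complexify ∘ u₀) k with hc₀_def
  have hc₀ : ∀ n, c₀ n ∈ W n := fun n =>
    Submodule.mem_inf.2 ⟨⟨isRealCoeff_mFourierCoeff (hu₀.integrable one_le_two),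
      isSolenoidalCoeff_restrict (hdiv.isTransversal_mFourierCoeff hu₀ (freqBall n))⟩,
      fun k hk => hu₀c k hk⟩
  have hWle : ∀ n, W n ≤ galerkinSubspace (freqBall n) := fun n => inf_le_left
  have hWinv : ∀ n t, ∀ c ∈ W n, galerkinRHS (freqBall n) ν (g' n t) c ∈ W n := fun n t c hc =>
    Submodule.mem_inf.2 ⟨galerkinRHS_mem ν (hS n) (hg'_real n t) (Submodule.mem_inf.1 hc).1,
      galerkinRHS_mem_axisCoeffSubspace ν (hg'_mem n t) (Submodule.mem_inf.1 hc).2⟩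
  -- the global Galerkin solutions
  have hsol : ∀ n : ℕ, ∃ α : ℝ → ↥(freqBall (d := d) n) → EuclideanSpace ℂ d,
      α 0 = c₀ n ∧ (∀ t, α t ∈ W n) ∧ ContinuousOn α (Ici 0) ∧
      ∀ T, ∀ t ∈ Icc 0 T, HasDerivWithinAt α (galerkinRHS (freqBall n) ν (g' n t) (α t))
        (Icc 0 T) t := fun n =>
    exists_galerkin_solution_of_invariant ν hν.le (hS n) (hg'_cont n) (hg'_real n) (W n) (hWle n)
      (hWinv n) (hc₀ n)
  choose α hα0 hαW hαcont hαderiv using hsol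
  have hαmem : ∀ n t, α n t ∈ galerkinSubspace (freqBall n) := fun n t => hWle n (hαW n t)
  have hαaxis : ∀ n t, α n t ∈ axisCoeffSubspace (freqBall n) i := fun n t =>
    (Submodule.mem_inf.1 (hαW n t)).2
  -- the scheme
  refine ⟨id, fun n t => realTrigPoly (freqBall n) (coeffExt (freqBall n) (g' n t)),
    fun n t => realTrigPoly (freqBall n) (coeffExt (freqBall n) (α n t)), ?_, ?_, ?_⟩
  · -- the datum is the Fourier truncation
    have hU0 : ∀ n, realTrigPoly (freqBall n) (coeffExt (freqBall n) (α n 0)) =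
        fourierTruncate n u₀ := by
      intro n
      rw [hα0 n, fourierTruncate_eq]
      exact realTrigPoly_coeffExt_restrict _
    -- band-limitation of Galerkin modes in `Finset` form
    have hband : ∀ {n : ℕ} {a : UnitAddTorus d → EuclideanSpace ℝ d}, IsGalerkinMode n a →
        ∀ k ∉ freqBall (d := d) n, mFourierCoeff (FunctionSpaces.EuclideanSpace.complexify ∘ a) k = 0 :=
      fun ha k hk => ha.mFourierCoeff_eq_zero (not_mem_freqBall.1 hk)
    exact
      { tendsto_order := tendsto_id
        smooth_force := fun n => contDiff_stLift_realTrigPoly (hg'_smooth n)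
        tendsto_force := hg'_tend
        continuousOn := fun n => continuousOn_stLift_realTrigPoly (hαcont n)
        isGalerkinMode := fun n t _ =>
          have h := galerkin_slice_props (hS n) (hαmem n t)
          ⟨h.1, h.2.1, fun k hk => h.2.2.2 k (not_mem_freqBall.2 hk)⟩
        isWeaklyDivFree := fun n t _ => (galerkin_slice_props (hS n) (hαmem n t)).2.2.1
        galerkin := fun n a ha s t hs hst =>
          galerkin_test_identity ν (hS n) (hg'_cont n) (hg'_real n) (hαmem n) (hαderiv n)
            ha.isSmooth ha.isDivFree (hband ha) hs hst
        energy_eq := fun n s t hs hst =>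
          galerkin_energy_identity ν (hS n) (hg'_cont n) (hg'_real n) (hαmem n) (hαderiv n) hs hst
        initial_inner := fun n a ha => by
          rw [hU0 n]
          exact integral_inner_fourierTruncate_eq hu₀ (ha.isSmooth.memLp 2) (hband ha)
        tendsto_initial := by
          have heq : (fun n => eLpNorm (realTrigPoly (freqBall n)
              (coeffExt (freqBall n) (α n 0)) - u₀) 2 volume) =
              fun n => eLpNorm (fourierTruncate n u₀ - u₀) 2 volume := by
            funext n; rw [hU0 n]
          rw [heq]
          exact tendsto_eLpNorm_fourierTruncate_sub hu₀ }
  · intro n t s x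
    exact realTrigPoly_add_single
      (fun k _ hk => coeffExt_eq_zero_of_mem_axisCoeffSubspace (hαaxis n t) hk) s x
  · intro n t s x
    exact realTrigPoly_add_single
      (fun k _ hk => coeffExt_eq_zero_of_mem_axisCoeffSubspace (hg'_mem n t) hk) s x

end Scheme

/-! ## The invariant limit field of an invariant scheme -/

section Limit

variable {ν : ℝ} {f : ℝ → UnitAddTorus d → EuclideanSpace ℝ d}
  {u₀ : UnitAddTorus d → EuclideanSpace ℝ d} {N : ℕ → ℕ}
  {F U : ℕ → ℝ → UnitAddTorus d → EuclideanSpace ℝ d}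

/-- **An `L²` field without modes `kᵢ ≠ 0` agrees a.e. with each of its axis translates**:
if `v ∈ L²(T^d; ℝ^d)` and `v̂(k) = 0` whenever `kᵢ ≠ 0`, then `v (· + s eᵢ) = v` a.e. for every
`s : UnitAddCircle` — the translate is in `L²` with coefficients `e_{kᵢ}(s) v̂(k) = v̂(k)`
(`Torus.mFourierCoeff_comp_add_single`), and `L²` fields with the same coefficients agree a.e.
(`Torus.ae_eq_of_mFourierCoeff_complexify_eq`). [folklore] -/
theorem Torus.translate_ae_eq_of_mFourierCoeff_eq_zero {i : d}
    {v : UnitAddTorus d → EuclideanSpace ℝ d} (hv : MemLp v 2 volume)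
    (h0 : ∀ k : d → ℤ, k i ≠ 0 → mFourierCoeff (FunctionSpaces.EuclideanSpace.complexify ∘ v) k = 0)
    (s : UnitAddCircle) : (fun x => v (x + Pi.single i s)) =ᵐ[volume] v := by
  refine Torus.ae_eq_of_mFourierCoeff_complexify_eq
    (hv.comp_measurePreserving
      (measurePreserving_add_right volume (Pi.single i s : UnitAddTorus d))) hv fun k => ?_
  have h := FunctionSpaces.Torus.mFourierCoeff_comp_add_single (FunctionSpaces.EuclideanSpace.complexify ∘ v) k i s
  have hcomp : (fun x : UnitAddTorus d => (FunctionSpaces.EuclideanSpace.complexify ∘ v) (x + Pi.single i s)) =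
      FunctionSpaces.EuclideanSpace.complexify ∘ fun x : UnitAddTorus d => v (x + Pi.single i s) := rfl
  rw [hcomp] at h
  rw [h]
  by_cases hk : k i = 0
  · rw [hk, fourier_zero, one_smul]
  · rw [h0 k hk, smul_zero]

/-- **The invariant limit field of an invariant Hopf–Galerkin scheme** (Hopf 1951, §4;
Robinson–Rodrigo–Sadowski 2016, Thm. 4.4 Step 3 and Thm. 4.11 — in the subspace of fields
invariant under the translations along the `i`-th axis). For a scheme with `ν ≥ 0`, `u₀ ∈ L²`,
`f ∈ L²ₜL²ₓ`, all of whose approximations `U n t`, `t ≥ 0`, are invariant under the translations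
`x ↦ x + s eᵢ`, there are a subsequence `φ` and a real field `u`, a.e. strongly measurable on
`(0, ∞) × T^d` (space–time lift), with `u t ∈ L²` and `Û_{φ j}(t, k) → û(t, k)` for **every**
`t ≥ 0` and every `k` — exactly the output of `IsHopfGalerkinScheme.exists_limitField` — and in
addition **every slice `u t` (all `t`) invariant under the same translations, at every point**.
Proof: the limit field of `exists_limitField` has no modes `kᵢ ≠ 0` for `t ≥ 0` (limits of
vanishing coefficients, `Torus.mFourierCoeff_eq_zero_of_forall_add_single`), hence agrees a.e.,
slice by slice for `t ≥ 0`, with its axis average `Torus.axisAvg i (u t)`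
(`Torus.translate_ae_eq_of_mFourierCoeff_eq_zero`, `Torus.axisAvg_ae_eq_of_forall_translate_ae_eq`),
which is invariant everywhere (`Torus.axisAvg_add_single`), has the same slicewise `L²`
membership and Fourier coefficients, and a measurable space–time lift
(`Torus.aestronglyMeasurable_stLift_axisAvg`). [cite: RobinsonRodrigoSadowski2016, Thm. 4.4 Step 3, Thm. 4.11] -/
theorem IsHopfGalerkinScheme.exists_invariant_limitField (hS : IsHopfGalerkinScheme ν f u₀ N F U)
    (hν : 0 ≤ ν) (hu₀ : MemLp u₀ 2 volume)
    (hfm : AEStronglyMeasurable (FunctionSpaces.Torus.stLift f) (volume.restrict (Ioi 0 ×ˢ univ)))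
    (hf₂ : ∀ T, 0 < T → ∫⁻ t in Ioo 0 T, ∫⁻ x, ‖f t x‖ₑ ^ 2 < ⊤) {i : d}
    (hUinv : ∀ n (t : ℝ), 0 ≤ t → ∀ (s : UnitAddCircle) (x : UnitAddTorus d),
      U n t (x + Pi.single i s) = U n t x) :
    ∃ φ : ℕ → ℕ, StrictMono φ ∧ ∃ u : ℝ → UnitAddTorus d → EuclideanSpace ℝ d,
      AEStronglyMeasurable (FunctionSpaces.Torus.stLift u) (volume.restrict (Ioi 0 ×ˢ univ)) ∧
      (∀ t, 0 ≤ t → MemLp (u t) 2 volume) ∧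
      (∀ t, 0 ≤ t → ∀ k, Tendsto
        (fun j => mFourierCoeff (FunctionSpaces.EuclideanSpace.complexify ∘ U (φ j) t) k) atTop
        (𝓝 (mFourierCoeff (FunctionSpaces.EuclideanSpace.complexify ∘ u t) k))) ∧
      ∀ (t : ℝ) (s : UnitAddCircle) (x : UnitAddTorus d), u t (x + Pi.single i s) = u t x := by
  obtain ⟨φ, hφ, u, hum, hu, hc⟩ := hS.exists_limitField hν hu₀ hfm hf₂
  -- the approximations, hence the limit, have no modes `k i ≠ 0`
  have hUc : ∀ n t, 0 ≤ t → ∀ k : d → ℤ, k i ≠ 0 →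
      mFourierCoeff (FunctionSpaces.EuclideanSpace.complexify ∘ U n t) k = 0 :=
    fun n t ht k hk => mFourierCoeff_eq_zero_of_forall_add_single
      (f := FunctionSpaces.EuclideanSpace.complexify ∘ U n t) (fun s x => by simp only [comp_apply, hUinv n t ht s x]) hk
  have huc : ∀ t, 0 ≤ t → ∀ k : d → ℤ, k i ≠ 0 →
      mFourierCoeff (FunctionSpaces.EuclideanSpace.complexify ∘ u t) k = 0 := by
    intro t ht k hk
    refine tendsto_nhds_unique (hc t ht k) ?_
    have h : (fun j => mFourierCoeff (FunctionSpaces.EuclideanSpace.complexify ∘ U (φ j) t) k) = fun _ => 0 :=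
      funext fun j => hUc (φ j) t ht k hk
    rw [h]
    exact tendsto_const_nhds
  -- the averaged field
  set ub : ℝ → UnitAddTorus d → EuclideanSpace ℝ d := fun t => axisAvg i (u t) with hub
  have hae : ∀ t, 0 ≤ t → ub t =ᵐ[volume] u t := fun t ht =>
    axisAvg_ae_eq_of_forall_translate_ae_eq ((hu t ht).integrable one_le_two)
      (translate_ae_eq_of_mFourierCoeff_eq_zero (hu t ht) (huc t ht))
  refine ⟨φ, hφ, ub, aestronglyMeasurable_stLift_axisAvg hum i, fun t ht =>
    (hu t ht).ae_eq (hae t ht).symm, fun t ht k => ?_, fun t s x => axisAvg_add_single i (u t) s x⟩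
  rw [FunctionSpaces.Torus.mFourierCoeff_congr_ae ((hae t ht).fun_comp FunctionSpaces.EuclideanSpace.complexify) k]
  exact hc t ht k

end Limit

/-! ## The named facts on `𝕋³` and the assembly of `hopf_existence_torus_invariant` -/

/-- Local notation for physical space `ℝ³ = EuclideanSpace ℝ (Fin 3)`. -/
local notation "ℝ³" => EuclideanSpace ℝ (Fin 3)

/-- Local notation for the flat unit torus `𝕋³ = UnitAddTorus (Fin 3)`. -/
local notation "𝕋³" => UnitAddTorus (Fin 3)

/-- **Existence of the Galerkin approximations in the `x₃`-invariant class**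
(Robinson–Rodrigo–Sadowski 2016, Thm. 4.4 (Hopf), Steps 1–2, pp. 73–75; Constantin–Foias 1988,
Ch. 8, (8.3)–(8.16); Hopf 1951, §§2–3 — the same Galerkin scheme run in the closed subspace of
`x₃`-independent fields, Majda–Bertozzi 2002, §2.3.1; Bruè–De Lellis 2023, §3.1). Let `ν > 0`,
let `u₀ ∈ L²(𝕋³)` be weakly divergence free, let `f` be a space–time measurable force with
`f ∈ L²((0, T) × 𝕋³)` for every `T > 0` (hypotheses verbatim those of
`hopf_existence_torus_invariant`), and assume `u₀` and every slice `f t` invariant under all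
translations `x ↦ x + s e₃` (`s : UnitAddCircle`, `e₃ = Pi.single 2`). Then there is a
Hopf–Galerkin scheme `(N, F, U)` for `(ν, f, u₀)` in the sense of `NS.IsHopfGalerkinScheme` all
of whose Galerkin approximations `U n t` and smoothed forces `F n t` are invariant under the same
translations. Folklore strengthening of the printed Steps 1–2 (no symmetry clause in print);
**discharged** below (`hopf_galerkin_scheme_exists_invariant_holds`). [folklore] [cite: RobinsonRodrigoSadowski2016, Thm. 4.4 Steps 1–2] [cite: Hopf1951, §§2–3] -/
def hopf_galerkin_scheme_exists_invariant : Prop :=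
  ∀ (ν : ℝ) (hν : 0 < ν) (u₀ : 𝕋³ → ℝ³) (hu₀ : MemLp u₀ 2 volume) (hdiv : FunctionSpaces.Torus.IsWeaklyDivFree u₀)
    (hu₀inv : ∀ (s : UnitAddCircle) (x : 𝕋³), u₀ (x + Pi.single (2 : Fin 3) s) = u₀ x)
    (f : ℝ → 𝕋³ → ℝ³)
    (hf : AEStronglyMeasurable (FunctionSpaces.Torus.stLift f) (volume.restrict (Ioi 0 ×ˢ univ)))
    (hf₂ : ∀ T, 0 < T → ∫⁻ t in Ioo 0 T, ∫⁻ x, ‖f t x‖ₑ ^ 2 < ∞)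
    (hfinv : ∀ (t : ℝ) (s : UnitAddCircle) (x : 𝕋³), f t (x + Pi.single (2 : Fin 3) s) = f t x),
    ∃ (N : ℕ → ℕ) (F U : ℕ → ℝ → 𝕋³ → ℝ³), IsHopfGalerkinScheme ν f u₀ N F U ∧
      (∀ n (t : ℝ) (s : UnitAddCircle) (x : 𝕋³), U n t (x + Pi.single (2 : Fin 3) s) = U n t x) ∧
      (∀ n (t : ℝ) (s : UnitAddCircle) (x : 𝕋³), F n t (x + Pi.single (2 : Fin 3) s) = F n t x)

/-- **Discharge of `hopf_galerkin_scheme_exists_invariant`**: by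
`exists_isHopfGalerkinScheme_invariant` in dimension `3` for the axis `i = 2`
(Robinson–Rodrigo–Sadowski 2016, Thm. 4.4 Steps 1–2, in the invariant subspace). [cite: RobinsonRodrigoSadowski2016, Thm. 4.4 Steps 1–2] -/
theorem hopf_galerkin_scheme_exists_invariant_holds : hopf_galerkin_scheme_exists_invariant :=
  fun ν hν u₀ hu₀ hdiv hu₀inv f hf hf₂ hfinv =>
    exists_isHopfGalerkinScheme_invariant ν hν u₀ hu₀ hdiv f hf hf₂ 2 hu₀inv hfinv

/-- **Passage to the limit in an `x₃`-invariant Galerkin scheme** (Robinson–Rodrigo–Sadowski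
2016, Thm. 4.4, Steps 3–4, pp. 75–77, Thm. 4.11 (compactness), Thm. 4.6 (strong energy
inequality), Thm. 3.8, Cor. 4.7; Constantin–Foias 1988, Ch. 8, (8.17), Lemmas 8.2–8.4 and
Theorem (Leray); Hopf 1951, §4 — in the closed subspace of `x₃`-independent fields,
Majda–Bertozzi 2002, §2.3.1; Bruè–De Lellis 2023, §3.1). Let `ν > 0` and let `u₀`, `f` be as in
`hopf_existence_torus` (no invariance of the data is assumed here). Every Hopf–Galerkin scheme
`(N, F, U)` for `(ν, f, u₀)` whose Galerkin approximations `U n t`, `t ≥ 0`, are invariant under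
all translations `x ↦ x + s e₃` yields a global Leray–Hopf weak solution `u` all of whose slices
`u t` (all `t`) are invariant under the same translations: along a subsequence the Fourier
coefficients `Û_n(t, k)` converge for every `t ≥ 0` (RRS (4.10)–(4.13)), so the limit
coefficients vanish at all `k` with `k₃ ≠ 0`, and the limit `L²` class is represented by its
`x₃`-average (`Torus.axisAvg`), an everywhere-invariant field in the same class, to which the
compactness / energy / weak-form arguments of the proof of `NS.hopf_galerkin_limit` apply
unchanged. Folklore strengthening of the printed Steps 3–4 (no symmetry clause in print); this is
the remaining named input of `hopf_existence_torus_invariant`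
(`hopf_existence_torus_invariant_of_galerkin_limit`). [folklore] [cite: RobinsonRodrigoSadowski2016, Thm. 4.4 Steps 3–4, Thm. 4.6, Cor. 4.7, Thm. 4.11] [cite: Hopf1951, §4] -/
def hopf_galerkin_limit_invariant : Prop :=
  ∀ (ν : ℝ) (hν : 0 < ν) (u₀ : 𝕋³ → ℝ³) (hu₀ : MemLp u₀ 2 volume) (hdiv : FunctionSpaces.Torus.IsWeaklyDivFree u₀)
    (f : ℝ → 𝕋³ → ℝ³) (hf : AEStronglyMeasurable (FunctionSpaces.Torus.stLift f) (volume.restrict (Ioi 0 ×ˢ univ)))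
    (hf₂ : ∀ T, 0 < T → ∫⁻ t in Ioo 0 T, ∫⁻ x, ‖f t x‖ₑ ^ 2 < ∞)
    (N : ℕ → ℕ) (F U : ℕ → ℝ → 𝕋³ → ℝ³) (hS : IsHopfGalerkinScheme ν f u₀ N F U)
    (hUinv : ∀ n (t : ℝ), 0 ≤ t → ∀ (s : UnitAddCircle) (x : 𝕋³),
      U n t (x + Pi.single (2 : Fin 3) s) = U n t x),
    ∃ u : ℝ → 𝕋³ → ℝ³, Torus.IsGlobalLerayHopf ν f u₀ u ∧
      ∀ (t : ℝ) (s : UnitAddCircle) (x : 𝕋³), u t (x + Pi.single (2 : Fin 3) s) = u t x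

/-- **Assembly of Hopf's existence theorem in the `x₃`-invariant class** (**ns.S06′**,
`NS.hopf_existence_torus_invariant` of `NSLerayHopf`) from its two halves: the invariant Galerkin
approximations exist (`hopf_galerkin_scheme_exists_invariant`; RRS 2016, Thm. 4.4, Steps 1–2) and
every invariant Galerkin scheme has an invariant Leray–Hopf limit (`hopf_galerkin_limit_invariant`;
RRS 2016, Thm. 4.4, Steps 3–4, Thm. 4.6, Cor. 4.7). Real proof (composition). [cite: RobinsonRodrigoSadowski2016, Thm. 4.4] -/
theorem hopf_existence_torus_invariant_of_galerkin (h₁ : hopf_galerkin_scheme_exists_invariant)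
    (h₂ : hopf_galerkin_limit_invariant) : hopf_existence_torus_invariant := by
  intro ν hν u₀ hu₀ hdiv hu₀inv f hf hf₂ hfinv
  obtain ⟨N, F, U, hS, hU, -⟩ := h₁ ν hν u₀ hu₀ hdiv hu₀inv f hf hf₂ hfinv
  exact h₂ ν hν u₀ hu₀ hdiv f hf hf₂ N F U hS fun n t _ => hU n t

/-- **`hopf_existence_torus_invariant` reduced to the passage to the limit**: with the first
half discharged (`hopf_galerkin_scheme_exists_invariant_holds`), **ns.S06′** follows from the
named fact `hopf_galerkin_limit_invariant` alone. Real proof. [cite: RobinsonRodrigoSadowski2016, Thm. 4.4] -/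
theorem hopf_existence_torus_invariant_of_galerkin_limit (h : hopf_galerkin_limit_invariant) :
    hopf_existence_torus_invariant :=
  hopf_existence_torus_invariant_of_galerkin hopf_galerkin_scheme_exists_invariant_holds h

/-! ### Discharge: the invariant passage to the limit, and ns.S06′ -/

/-- **Discharge of `hopf_galerkin_limit_invariant`** (Robinson–Rodrigo–Sadowski 2016, Thm. 4.4
Steps 3–4, Thm. 4.6, Cor. 4.7, Thm. 4.11; Constantin–Foias 1988, Ch. 8, Theorem (Leray); Hopf
1951, §4 — in the `x₃`-invariant subspace): the invariant limit field of
`IsHopfGalerkinScheme.exists_invariant_limitField` is, along the extracted subsequence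
(`IsHopfGalerkinScheme.comp_strictMono`), a coefficientwise limit of the scheme with `L²` slices
and measurable lift, hence Leray–Hopf on every `[0, T)` by
`IsHopfGalerkinScheme.isLerayHopfOn_limit` (`NSHopfGalerkinLimit`), and it is invariant at every
point. [cite: RobinsonRodrigoSadowski2016, Thm. 4.4 Steps 3–4, Thm. 4.6, Cor. 4.7, Thm. 4.11] -/
theorem hopf_galerkin_limit_invariant_holds : hopf_galerkin_limit_invariant := by
  intro ν hν u₀ hu₀ hdiv f hf hf₂ N F U hS hUinv
  obtain ⟨φ, hφ, u, hum, hu, hc, hinv⟩ := hS.exists_invariant_limitField hν.le hu₀ hf hf₂ hUinv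
  exact ⟨u, fun T hT => (hS.comp_strictMono hφ).isLerayHopfOn_limit hν hu₀ hdiv hf hf₂ hum hu hc hT,
    hinv⟩

/-- **Discharge of ns.S06′ `NS.hopf_existence_torus_invariant`** (`NSLerayHopf`; Hopf 1951,
§§2–4, and Robinson–Rodrigo–Sadowski 2016, Thm. 4.4, run in the closed `x₃`-invariant class —
Majda–Bertozzi 2002, §2.3.1, Prop. 2.7; Bruè–De Lellis 2023, §3.1): for `ν > 0`, a weakly
divergence-free datum `u₀ ∈ L²(𝕋³)` and a space–time measurable force `f ∈ L²((0,T) × 𝕋³)` for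
all `T`, both invariant under all translations `x ↦ x + s e₃`, there is a global Leray–Hopf weak
solution all of whose slices are invariant under the same translations. Real proof:
`hopf_existence_torus_invariant_of_galerkin` with both halves discharged
(`hopf_galerkin_scheme_exists_invariant_holds`, `hopf_galerkin_limit_invariant_holds`). [cite: Hopf1951, §§2–4] [cite: RobinsonRodrigoSadowski2016, Thm. 4.4] -/
theorem hopf_existence_torus_invariant_holds : hopf_existence_torus_invariant :=
  hopf_existence_torus_invariant_of_galerkin hopf_galerkin_scheme_exists_invariant_holds
    hopf_galerkin_limit_invariant_holds

end NS

end Literature.Analysis.FluidPDE
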